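import Literature.Computability.AlgebraicComplexity.GraphTensor
import HarnessLib

/-!
# The triangle `K_3 = C_3`: `T_n(K_3)` is the matrix multiplication tensor `⟨n,n,n⟩`, so `ω(T(K_3)) = ω` and
# `τ(T(K_3)) = ω/3` (Christandl–Vrana–Zuiddam 2019, Ex. 1.1.2, Def. 1.1.22, §1.2)

Topic `Literature/Computability/AlgebraicComplexity`, sequel of `GraphTensor.lean` (`graphTensor`, `graphOmega`,
`graphTau`, `cliqueSlots`, `tetraSlots`, the named fact `cvz19_prop_1_1_26`) and of
`MatrixMultiplicationExponent.lean` / `FlatteningBound.lean` (`matMulTensor`, `tensorRank`, `admissibleExponents`,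
`omega`).  Definition item `defn-GraphTensor` (route `route-MatrixMultiplication-TetrahedronCarving`).

## What is printed

[CVZ19] Christandl–Vrana–Zuiddam, arXiv:1609.07476: Ex. 1.1.2 (p. 4) "`T_n(K_3) = ∑_{i∈[n]^3} b_{i₁i₂} ⊗ b_{i₂i₃}
⊗ b_{i₃i₁} ∈ ℂ^{n²} ⊗ ℂ^{n²} ⊗ ℂ^{n²}` … In algebraic complexity theory, the tensor `T_n(C_3)` is called the `n × n`
matrix multiplication tensor … It is usually denoted by `⟨n,n,n⟩`. … Note that `C_3 = K_3`"; Def. 1.1.22 (p. 6)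
"Define the real number `ω := ω(T(C_3))`. This number is called the exponent of matrix multiplication."; §1.2
(p. 9) "`τ(T(K_3)) = ω/3` and thus by Prop. 1.1.26 we have `τ(T(K_k)) ≤ ω/3` for all `k ≥ 3`."

## What is typed (all PROVED, 0 named facts)

* `triangleSlots` (`K_3` with edges `Fin 3` = `01, 02, 12`), `triangleEdge` (its edge names in `CliqueEdge 3`),
  `graphTensor_cliqueSlots_two : graphTensor F (cliqueSlots 2) n = graphTensor F triangleSlots n` (relabelling);
* `pairIndex n : Fin n × Fin n ≃ Fin (n^2)`; **`graphTensor_triangleSlots_apply`**: with pair labels `a, b` on legs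
  `0, 1` and the swapped pair on leg `2`, `T_n(K_3)(a, b, c.swap) = ⟨n,n,n⟩(a, b, c)` for the tree's `matMulTensor`
  (index test `a.1 = b.1 ∧ b.2 = c.1 ∧ a.2 = c.2`) — Ex. 1.1.2 entry by entry, the only freedom being the order of
  the two slot coordinates at vertex `2`;
* **`tensorRankD_triangle_eq : R₃(T_n(K_3)) = R(⟨n,n,n⟩)`** (the cubic-format rank `tensorRankD` against Bläser's
  triad rank `tensorRank`, by transporting decompositions both ways along the pair labels);
* `graphExponents_triangleSlots = admissibleExponents F`, **`graphOmega_triangleSlots : ω(T(K_3)) = omega F`**,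
  `graphOmega_cliqueSlots_two`, **`graphTau_cliqueSlots_two : τ(T(K_3)) = omega F / 3`** (Def. 1.1.22, §1.2) —
  over every field `F`;
* corollaries of the named fact `cvz19_prop_1_1_26` (clique monotonicity of `τ`, as printed at `ℂ`):
  `cvz19_prop_1_1_26.graphTau_clique_le_omega_div_three` (`τ(T(K_k)) ≤ ω/3`, `k ≥ 3` — the printed triangle
  cover (1.5)) and `cvz19_prop_1_1_26.graphOmega_tetraSlots_le_two_mul_omega` (`ω(T(K_4)) ≤ 2ω`; the tree has the
  unconditional re-proof `Summit.MatrixMultiplication.….TetrahedronTensor.omegaTetra_le_two_mul_omega` for its own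
  `tetra`, which is `graphTensor F tetraSlots` by `tetra_eq_sum`).

No `sorry`, no axiom, no instance, no notation, no `Prop`-valued definition.

## References

* [CVZ19] Christandl–Vrana–Zuiddam, arXiv:1609.07476, Ex. 1.1.2, Def. 1.1.22, Prop. 1.1.26, §1.2 (eq. (1.5)).
  [ChristandlVranaZuiddam2016]
* M. Bläser, *Fast Matrix Multiplication*, Theory of Computing Graduate Surveys 5 (2013), §5 (the tensor
  `⟨k,m,n⟩`, Def. 5.1 `ω`). [Blaser2013]
-/

noncomputable section

open scoped BigOperators
open Filter Asymptotics

namespace Literature.Computability.AlgebraicComplexity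

section Triangle

variable (F : Type*) [Field F]

/-- Incidence slots of the triangle `K_3` with edges `Fin 3` in the order `01, 02, 12`, each vertex
reading its two edges in increasing order of the other endpoint (CVZ19 Ex. 1.1.2:
`T_n(K_3) = ∑ b_{i₁i₂} ⊗ b_{i₂i₃} ⊗ b_{i₃i₁}`, up to the order of edges and of slot coordinates).
[cite: ChristandlVranaZuiddam2016, Ex. 1.1.2] -/
def triangleSlots : Fin 3 → Fin 2 → Fin 3 :=
  ![![0, 1], ![0, 2], ![1, 2]]

/-- Every edge of the triangle is read. [cite: ChristandlVranaZuiddam2016, Ex. 1.1.2] -/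
theorem triangleSlots_covering : ∀ e, ∃ v j, triangleSlots v j = e := by
  decide

/-- The edge names of `triangleSlots` inside `CliqueEdge 3`: `0 ↦ {0,1}, 1 ↦ {0,2}, 2 ↦ {1,2}`.
[cite: ChristandlVranaZuiddam2016, Ex. 1.1.2] -/
def triangleEdge : Fin 3 → CliqueEdge 3 :=
  ![⟨s(0, 1), by decide⟩, ⟨s(0, 2), by decide⟩, ⟨s(1, 2), by decide⟩]

/-- `triangleEdge` is injective. [cite: ChristandlVranaZuiddam2016, Ex. 1.1.2] -/
theorem triangleEdge_injective : Function.Injective triangleEdge := by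
  intro a b h
  have h' := congrArg Subtype.val h
  fin_cases a <;> fin_cases b <;> first | rfl | (exfalso; revert h'; decide)

/-- `triangleEdge` is a bijection `Fin 3 ≃ E(K_3)`. [cite: ChristandlVranaZuiddam2016, Ex. 1.1.2] -/
theorem triangleEdge_bijective : Function.Bijective triangleEdge := by
  rw [Fintype.bijective_iff_injective_and_card]
  exact ⟨triangleEdge_injective, by rw [card_cliqueEdge]; decide⟩

/-- The slot tables agree: `cliqueSlots 2 v j = triangleEdge (triangleSlots v j)`. [cite: ChristandlVranaZuiddam2016, Ex. 1.1.2] -/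
theorem cliqueSlots_two_eq (v : Fin 3) (j : Fin 2) :
    cliqueSlots 2 v j = triangleEdge (triangleSlots v j) := by
  apply Subtype.ext
  fin_cases v <;> fin_cases j <;> decide

/-- `K_3` two ways: the clique presentation `cliqueSlots 2` gives literally the triangle tensor of
`triangleSlots`. [cite: ChristandlVranaZuiddam2016, Ex. 1.1.2] -/
theorem graphTensor_cliqueSlots_two (n : ℕ) :
    graphTensor F (cliqueSlots 2) n = graphTensor F triangleSlots n := by
  have h : cliqueSlots 2 =
      fun v j => (Equiv.ofBijective triangleEdge triangleEdge_bijective) (triangleSlots v j) := by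
    funext v j
    exact cliqueSlots_two_eq v j
  rw [h, graphTensor_relabel]

/-- Pair labels: `Fin n × Fin n ≃ Fin (n^2)` through `finFunctionFinEquiv` on `Fin 2 → Fin n` (the
leg format `F^{n²}` of `T_n(K_3)`). [cite: ChristandlVranaZuiddam2016, Ex. 1.1.2] -/
def pairIndex (n : ℕ) : Fin n × Fin n ≃ Fin (n ^ 2) :=
  (finTwoArrowEquiv (Fin n)).symm.trans finFunctionFinEquiv

variable {F}

/-- The leg indices of `T_n(K_3)` for the labelling `l`: vertex `0` reads `(l₀₁, l₀₂)`, vertex `1`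
reads `(l₀₁, l₁₂)`, vertex `2` reads `(l₀₂, l₁₂)`. [cite: ChristandlVranaZuiddam2016, Ex. 1.1.2] -/
theorem slotIndex_triangleSlots {n : ℕ} (l : Fin 3 → Fin n) :
    slotIndex triangleSlots l = ![pairIndex n (l 0, l 1), pairIndex n (l 0, l 2), pairIndex n (l 1, l 2)] := by
  funext v
  fin_cases v <;>
  · show finFunctionFinEquiv _ = finFunctionFinEquiv _
    congr 1
    funext j
    fin_cases j <;> rfl

/-- **`T_n(K_3)` is the matrix multiplication tensor `⟨n,n,n⟩`** (CVZ19 Ex. 1.1.2: "the tensor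
`T_n(C_3)` is called the `n × n` matrix multiplication tensor … `⟨n,n,n⟩`"), entry by entry: with pair
labels `a, b` on legs `0, 1` and the SWAPPED pair on leg `2` (the tree's `matMulTensor F n n n a b c`
tests `a.1 = b.1 ∧ b.2 = c.1 ∧ a.2 = c.2`), `T_n(K_3)(a, b, c.swap) = ⟨n,n,n⟩(a, b, c)`.
[cite: ChristandlVranaZuiddam2016, Ex. 1.1.2] -/
theorem graphTensor_triangleSlots_apply {n : ℕ} (a b c : Fin n × Fin n) :
    graphTensor F triangleSlots n ![pairIndex n a, pairIndex n b, pairIndex n c.swap] =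
      matMulTensor F n n n a b c := by
  classical
  rw [graphTensor_apply_of_covering triangleSlots_covering]
  unfold matMulTensor
  refine if_congr ?_ rfl rfl
  constructor
  · rintro ⟨l, hl⟩
    rw [slotIndex_triangleSlots] at hl
    have h0 := congrFun hl 0
    have h1 := congrFun hl 1
    have h2 := congrFun hl 2
    simp only [Matrix.cons_val_zero, Matrix.cons_val_one, Matrix.cons_val_two, Matrix.head_cons,
      Matrix.tail_cons, Equiv.apply_eq_iff_eq] at h0 h1 h2
    rw [← h0, ← h1]
    have hc : c = (l 2, l 1) := by
      rw [← Prod.swap_inj, ← h2]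
      rfl
    rw [hc]
    exact ⟨rfl, rfl, rfl⟩
  · rintro ⟨h01, h12, h02⟩
    refine ⟨![a.1, a.2, b.2], ?_⟩
    rw [slotIndex_triangleSlots]
    obtain ⟨a1, a2⟩ := a
    obtain ⟨b1, b2⟩ := b
    obtain ⟨c1, c2⟩ := c
    simp only at h01 h12 h02
    subst h01 h12 h02
    rfl

/-- The inverse reading: every entry of `T_n(K_3)` is an entry of `⟨n,n,n⟩`.
[cite: ChristandlVranaZuiddam2016, Ex. 1.1.2] -/
theorem graphTensor_triangleSlots_apply' {n : ℕ} (i : Fin 3 → Fin (n ^ 2)) :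
    graphTensor F triangleSlots n i =
      matMulTensor F n n n ((pairIndex n).symm (i 0)) ((pairIndex n).symm (i 1))
        ((pairIndex n).symm (i 2)).swap := by
  rw [← graphTensor_triangleSlots_apply]
  congr 1
  funext v
  fin_cases v <;> simp [Prod.swap_swap]

/-- `R(⟨n,n,n⟩) ≤ R₃(T_n(K_3))`: a rank-one decomposition of `T_n(K_3)` restricts along the pair
labels to a triad decomposition of `⟨n,n,n⟩`. [cite: ChristandlVranaZuiddam2016, Ex. 1.1.2] -/
theorem tensorRank_matMulTensor_le_tensorRankD_triangle (n : ℕ) :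
    tensorRank (matMulTensor F n n n) ≤ tensorRankD (graphTensor F triangleSlots n) := by
  classical
  obtain ⟨g, hg, hsum⟩ := sComplexity_spec (graphTensor_decomposable (F := F) triangleSlots n)
  simp only [rankOneTensors, Set.mem_range] at hg
  choose u hu using hg
  refine tensorRank_le_of_eq_sum (fun k a => u k 0 (pairIndex n a)) (fun k b => u k 1 (pairIndex n b))
    (fun k c => u k 2 (pairIndex n c.swap)) ?_
  funext a b c
  have h := congrFun hsum ![pairIndex n a, pairIndex n b, pairIndex n c.swap]
  rw [Finset.sum_apply] at h
  rw [← graphTensor_triangleSlots_apply, ← h, Finset.sum_apply, Finset.sum_apply, Finset.sum_apply]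
  refine Finset.sum_congr rfl fun k _ => ?_
  rw [← hu k, rankOneTensor_apply, Fin.prod_univ_three, triad_apply]
  rfl

/-- `R₃(T_n(K_3)) ≤ R(⟨n,n,n⟩)`: a triad decomposition of `⟨n,n,n⟩` transports along the pair labels
to a rank-one decomposition of `T_n(K_3)`. [cite: ChristandlVranaZuiddam2016, Ex. 1.1.2] -/
theorem tensorRankD_triangle_le_tensorRank_matMulTensor (n : ℕ) :
    tensorRankD (graphTensor F triangleSlots n) ≤ tensorRank (matMulTensor F n n n) := by
  classical
  obtain ⟨w, u, v, hdec⟩ := exists_triad_decomposition_tensorRank (matMulTensor F n n n)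
  refine tensorRankD_le_of_eq_sum
    (fun k => ![fun x => w k ((pairIndex n).symm x), fun x => u k ((pairIndex n).symm x),
      fun x => v k ((pairIndex n).symm x).swap]) ?_
  funext i
  rw [Finset.sum_apply, graphTensor_triangleSlots_apply']
  have h := congrFun (congrFun (congrFun hdec ((pairIndex n).symm (i 0))) ((pairIndex n).symm (i 1)))
    ((pairIndex n).symm (i 2)).swap
  rw [Finset.sum_apply, Finset.sum_apply, Finset.sum_apply] at h
  rw [h]
  refine Finset.sum_congr rfl fun k _ => ?_
  rw [rankOneTensor_apply, Fin.prod_univ_three, triad_apply]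
  rfl

/-- **`R₃(T_n(K_3)) = R(⟨n,n,n⟩)`** — the triangle tensor in the cubic format has the rank of the
tree's matrix multiplication tensor (CVZ19 Ex. 1.1.2 / Def. 1.1.22). [cite: ChristandlVranaZuiddam2016, Ex. 1.1.2] -/
theorem tensorRankD_triangle_eq (n : ℕ) :
    tensorRankD (graphTensor F triangleSlots n) = tensorRank (matMulTensor F n n n) :=
  le_antisymm (tensorRankD_triangle_le_tensorRank_matMulTensor n)
    (tensorRank_matMulTensor_le_tensorRankD_triangle n)

variable (F)

/-- The admissible exponents of `T(K_3)` are the tree's `admissibleExponents` (Bläser's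
`{β | R(⟨n,n,n⟩) = O(n^β)}`). [cite: ChristandlVranaZuiddam2016, Def. 1.1.22] -/
theorem graphExponents_triangleSlots : graphExponents F triangleSlots = admissibleExponents F := by
  ext β
  simp only [mem_graphExponents_iff, admissibleExponents, Set.mem_setOf_eq, tensorRankD_triangle_eq]

/-- **`ω(T(K_3)) = ω`** — CVZ19 Def. 1.1.22 "`ω := ω(T(C_3))` … the exponent of matrix
multiplication" is the tree's `omega`. [cite: ChristandlVranaZuiddam2016, Def. 1.1.22] -/
theorem graphOmega_triangleSlots : graphOmega F triangleSlots = omega F := by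
  unfold graphOmega omega
  rw [graphExponents_triangleSlots]

/-- `ω(T(K_3)) = ω` in the clique presentation. [cite: ChristandlVranaZuiddam2016, Def. 1.1.22] -/
theorem graphOmega_cliqueSlots_two : graphOmega F (cliqueSlots 2) = omega F := by
  have h : cliqueSlots 2 =
      fun v j => (Equiv.ofBijective triangleEdge triangleEdge_bijective) (triangleSlots v j) := by
    funext v j
    exact cliqueSlots_two_eq v j
  rw [h, graphOmega_relabel, graphOmega_triangleSlots]

/-- **`τ(T(K_3)) = ω/3`** (CVZ19 §1.2: "`τ(T(K_3)) = ω/3`"). [cite: ChristandlVranaZuiddam2016, §1.2 (eq. (1.5))] -/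
theorem graphTau_cliqueSlots_two : graphTau F (cliqueSlots 2) = omega F / 3 := by
  unfold graphTau
  rw [graphOmega_cliqueSlots_two, card_cliqueEdge]
  norm_num [Nat.choose]

/-- **The triangle cover through Prop. 1.1.26**: `τ(T(K_k)) ≤ ω/3` for all `k ≥ 3` (CVZ19 §1.2:
"thus by Prop. 1.1.26 we have `τ(T(K_k)) ≤ ω/3` for all `k ≥ 3`"), from the named fact
`cvz19_prop_1_1_26` and the PROVED `τ(T(K_3)) = ω/3`. [cite: ChristandlVranaZuiddam2016, §1.2 (eq. (1.5))] -/
theorem cvz19_prop_1_1_26.graphTau_clique_le_omega_div_three (h : cvz19_prop_1_1_26) {d : ℕ}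
    (hd : 2 ≤ d) : graphTau ℂ (cliqueSlots d) ≤ omega ℂ / 3 := by
  rw [← graphTau_cliqueSlots_two ℂ]
  exact h d 2 (by norm_num) hd

/-- At `k = 4`: `ω(T(K_4)) ≤ 2ω` (CVZ19 Prop. 1.1.26 with `k = 4, ℓ = 3`; re-proved for the tree's
`tetra` as `Summit.MatrixMultiplication.….omegaTetra_le_two_mul_omega`). [cite: ChristandlVranaZuiddam2016, Prop. 1.1.26] -/
theorem cvz19_prop_1_1_26.graphOmega_tetraSlots_le_two_mul_omega (h : cvz19_prop_1_1_26) :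
    graphOmega ℂ tetraSlots ≤ 2 * omega ℂ := by
  have h4 := h.graphTau_clique_le_omega_div_three (by norm_num : 2 ≤ 3)
  rw [graphTau_cliqueSlots_three] at h4
  linarith

end Triangle

end Literature.Computability.AlgebraicComplexity

end
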